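import Summits.CriticalPhenomena.SAWScalingLimit.Theorems.SAWTotalPositivityCriticalBubbleBoundJoinInjective

/-!
# The injection input of the join-mass ledger: `D_i ≤ 64 x_c^{-16} U_i`
(crux `SAWTotalPositivity.CriticalBubbleBound`, stmt-CriticalPhenomena-7117; line `docking-census-joining`,
registered stub `Dent_le_Urar` of the join-mass programme, wave 3 / S12, lead prover c6)

For scales `i ≥ 5`, every arrow `(n, n', χ¹, χ², k)` counted by the entropy mass `Dent i` (`n, n' ∈ B_i`,
classes of walk lengths `j = n - 17`, `m = n' - 17 ≥ 15`, `k` an admissible offset) is sent to the index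
`(n + n', re-rooted join class, re-rooted junction corner, tag codes)` of `64 · Urar i` — by
`joinPoly_reroot` the re-rooted join is a class of walk length `n + n' - 17` with `n + n' ∈ B_{i+1}` and the
corner a GLOBAL join plaquette of it —, injectively by `joinArrow_injective`, and the weights match up to
the factor `x_c^{-16}`: `x_c^{(j+1)+(m+1)} = x_c^{-16} x_c^{(n+n'-17)+1}`. (Scales `i ≤ 4` are excluded: the
block `[16, 32)` contains the one-edge class `m = 1`, outside the joining range `m ≥ 3`; the ledger is fed
`D_i := 0` there.) [cite: Hammond2015SAPJoining, Lemma 4.12]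
-/

noncomputable section

open Literature.Probability.LatticeModels
open Literature.Probability.RandomPlanarGeometry Literature.Probability.RandomPlanarGeometry.SAW
open scoped BigOperators
open Summit.CriticalPhenomena.SAWScalingLimit.Theorems.CriticalBubbleBound.Negative (e₀)
open Summit.CriticalPhenomena.SAWScalingLimit.Theorems.CriticalBubbleBound.Docking
open Literature.Probability.Percolation (zdShiftIso)

namespace Summit.CriticalPhenomena.SAWScalingLimit.Theorems.CriticalBubbleBound.Join

/-! ## The injection bound -/

/-- **Stub `Dent_le_Urar` (the INJECTION input `D_i ≤ 64 μ^16 U_i` of the ledger), scales `i ≥ 5`.**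
An arrow `(n, n', χ¹, χ², k)` of `Dent i` (`n, n' ∈ B_i`, so `j = n - 17, m = n' - 17 ≥ 15`) is sent to
`(n + n', re-rooted join class, re-rooted junction corner, the two case-tag codes)`, an index of
`64 · Urar i` (`joinPoly_reroot`: the class is lex-rooted of walk length `n + n' - 17` and the corner is a
global join plaquette; the tags are coded in `range 8 × range 8`); the map is injective
(`joinArrow_injective`) and carries the weight `x_c^{(j+1)+(m+1)} = x_c^{-16} · x_c^{(n+n'-17)+1}`; the
remaining terms are nonnegative. (At scale `i = 4` the block `[16,32)` contains `n' = 18`, i.e. the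
one-edge class `m = 1`, outside the joining range `m ≥ 3`.) [cite: Hammond2015SAPJoining, Lemma 4.12] -/
theorem Dent_le_Urar : ∀ i : ℕ, 5 ≤ i → Dent i ≤ 64 * criticalFugacity⁻¹ ^ 16 * Urar i := by
  intro i hi
  classical
  have hx0 : 0 < criticalFugacity := criticalFugacity_pos_lt_one'.1
  have h32 : 32 ≤ 2 ^ i :=
    le_trans (by norm_num) (Nat.pow_le_pow_right (by norm_num) hi)
  have hblk : ∀ n ∈ block i, joinShift ≤ n ∧ 3 ≤ n - joinShift := fun n hn => by
    rw [block, Finset.mem_Ico] at hn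
    simp only [joinShift]
    omega
  -- tag codes
  obtain ⟨code, hcode, hcode8⟩ : ∃ code : JCase → ℕ, Function.Injective code ∧ ∀ c, code c < 8 :=
    ⟨fun c => match c with
      | .Aup => 0 | .Adown => 1 | .B1 => 2 | .B2a => 3 | .B2b => 4 | .C1 => 5 | .C2a => 6 | .C2b => 7,
     fun a b h => by cases a <;> cases b <;> first | rfl | simp at h,
     fun c => by cases c <;> decide⟩
  -- the two index finsets
  set T := (((block i ×ˢ block i).sigma fun nn : ℕ × ℕ =>
      lexRooted (nn.1 - joinShift) ×ˢ lexRooted (nn.2 - joinShift)).sigma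
    fun p => offsets (p.1.1 - joinShift) (p.1.2 - joinShift) p.2.1 p.2.2) with hT
  set U := ((((block (i + 1)).filter fun n => joinShift ≤ n).sigma fun n : ℕ =>
      lexRooted (n - joinShift)).sigma fun p => gjoins (p.1 - joinShift) p.2) ×ˢ
    (Finset.range 8 ×ˢ Finset.range 8) with hU
  have hL : Dent i = ∑ t ∈ T,
      criticalFugacity ^ (t.1.1.1 - joinShift + 1 + (t.1.1.2 - joinShift + 1)) := by
    rw [Dent, hT, Finset.sum_sigma, Finset.sum_sigma, Finset.sum_product]
    refine Finset.sum_congr rfl fun n hn => Finset.sum_congr rfl fun n' hn' => ?_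
    rw [if_pos ⟨(hblk n hn).1, (hblk n' hn').1⟩, Finset.sum_product]
    refine Finset.sum_congr rfl fun χ₁ _ => Finset.sum_congr rfl fun χ₂ _ => ?_
    dsimp only
    rw [Finset.sum_const, nsmul_eq_mul]
  have hR : 64 * criticalFugacity⁻¹ ^ 16 * Urar i =
      ∑ u ∈ U, criticalFugacity⁻¹ ^ 16 * criticalFugacity ^ (u.1.1.1 - joinShift + 1) := by
    rw [hU, Finset.sum_product, Finset.sum_sigma, Finset.sum_sigma, Urar, ← Finset.sum_filter,
      Finset.mul_sum]
    refine Finset.sum_congr rfl fun n _ => ?_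
    rw [Finset.mul_sum]
    refine Finset.sum_congr rfl fun χ _ => ?_
    dsimp only
    rw [Finset.sum_const, Finset.sum_const, Finset.card_product, Finset.card_range, smul_smul,
      nsmul_eq_mul]
    push_cast
    ring
  -- the arrow, as a relation with an image for every index of `Dent i`
  have himg : ∀ t : (_ : (_ : ℕ × ℕ) × ((ℕ → Site 2) × (ℕ → Site 2))) × ℤ,
      ∃ u : ((_ : (_ : ℕ) × (ℕ → Site 2)) × Site 2) × (ℕ × ℕ), t ∈ T →
        u ∈ U ∧
        criticalFugacity ^ (t.1.1.1 - joinShift + 1 + (t.1.1.2 - joinShift + 1)) =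
          criticalFugacity⁻¹ ^ 16 * criticalFugacity ^ (u.1.1.1 - joinShift + 1) ∧
        u.1.1.1 = t.1.1.1 + t.1.1.2 ∧
        u.1.1.2 = rerootWalk (joinPoly (t.1.1.1 - joinShift) (t.1.1.2 - joinShift) t.1.2.1 t.1.2.2 t.2)
          (t.1.1.1 - joinShift + (t.1.1.2 - joinShift) + 17) ∧
        u.1.2 = rerootSite (joinPoly (t.1.1.1 - joinShift) (t.1.1.2 - joinShift) t.1.2.1 t.1.2.2 t.2)
          (joinCorner (t.1.1.1 - joinShift) (t.1.1.2 - joinShift) t.1.2.1 t.1.2.2 t.2) ∧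
        u.2 = (code (joinTags (t.1.1.1 - joinShift) (t.1.1.2 - joinShift) t.1.2.1 t.1.2.2 t.2).1,
          code (joinTags (t.1.1.1 - joinShift) (t.1.1.2 - joinShift) t.1.2.1 t.1.2.2 t.2).2) := by
    rintro ⟨⟨⟨n, n'⟩, χ₁, χ₂⟩, k⟩
    by_cases ht : (⟨⟨(n, n'), (χ₁, χ₂)⟩, k⟩ :
        (_ : (_ : ℕ × ℕ) × ((ℕ → Site 2) × (ℕ → Site 2))) × ℤ) ∈ T
    · have ht' := ht
      simp only [hT, Finset.mem_sigma, Finset.mem_product] at ht'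
      obtain ⟨⟨⟨hn, hn'⟩, hχ₁, hχ₂⟩, hk⟩ := ht'
      obtain ⟨h17, h3⟩ := hblk n hn
      obtain ⟨h17', h3'⟩ := hblk n' hn'
      obtain ⟨hcls, -, hgj⟩ := joinPoly_reroot _ _ _ _ _ hχ₁ hχ₂ h3 h3' hk
      have e1 : n + n' - joinShift = n - joinShift + (n' - joinShift) + 17 := by
        simp only [joinShift] at *
        omega
      refine ⟨(⟨⟨n + n', rerootWalk (joinPoly (n - joinShift) (n' - joinShift) χ₁ χ₂ k)
          (n - joinShift + (n' - joinShift) + 17)⟩,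
        rerootSite (joinPoly (n - joinShift) (n' - joinShift) χ₁ χ₂ k)
          (joinCorner (n - joinShift) (n' - joinShift) χ₁ χ₂ k)⟩,
        (code (joinTags (n - joinShift) (n' - joinShift) χ₁ χ₂ k).1,
          code (joinTags (n - joinShift) (n' - joinShift) χ₁ χ₂ k).2)),
        fun _ => ⟨?_, ?_, ?_, ?_, ?_, ?_⟩⟩
      · simp only [hU, Finset.mem_product, Finset.mem_sigma, Finset.mem_filter, Finset.mem_range]
        refine ⟨⟨⟨⟨?_, by omega⟩, ?_⟩, ?_⟩, hcode8 _, hcode8 _⟩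
        · rw [block, Finset.mem_Ico, pow_succ] at hn hn'
          rw [block, Finset.mem_Ico, pow_succ, pow_succ]
          omega
        · rw [e1]
          exact hcls
        · show rerootSite _ _ ∈ gjoins (n + n' - joinShift) _
          rw [e1]
          exact hgj
      · dsimp only
        have e2 : n + n' - joinShift + 1 = n - joinShift + 1 + (n' - joinShift + 1) + 16 := by
          simp only [joinShift] at *
          omega
        rw [e2, pow_add criticalFugacity (n - joinShift + 1 + (n' - joinShift + 1)) 16, mul_left_comm,
          ← mul_pow, inv_mul_cancel₀ hx0.ne', one_pow, mul_one]
      · dsimp only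
      · dsimp only
      · dsimp only
      · dsimp only
    · exact ⟨((⟨⟨0, fun _ => 0⟩, 0⟩, (0, 0))), fun h => (ht h).elim⟩
  choose Φ hΦ using himg
  -- injectivity
  have hinj : Set.InjOn Φ ↑T := by
    rintro ⟨⟨⟨n₁, n₁'⟩, χ₁, χ₂⟩, k₁⟩ ht₁ ⟨⟨⟨n₂, n₂'⟩, η₁, η₂⟩, k₂⟩ ht₂ heq
    rw [Finset.mem_coe] at ht₁ ht₂
    obtain ⟨-, -, hN₁, hW₁, hS₁, hT₁⟩ := hΦ _ ht₁
    obtain ⟨-, -, hN₂, hW₂, hS₂, hT₂⟩ := hΦ _ ht₂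
    rw [heq] at hN₁ hW₁ hS₁ hT₁
    simp only [hT, Finset.mem_sigma, Finset.mem_product] at ht₁ ht₂
    obtain ⟨⟨⟨hn₁, hn₁'⟩, hχ₁, hχ₂⟩, hk₁⟩ := ht₁
    obtain ⟨⟨⟨hn₂, hn₂'⟩, hη₁, hη₂⟩, hk₂⟩ := ht₂
    dsimp only at hN₁ hW₁ hS₁ hT₁ hN₂ hW₂ hS₂ hT₂ hχ₁ hχ₂ hk₁ hη₁ hη₂ hk₂
    obtain ⟨a₁, b₁⟩ := hblk n₁ hn₁
    obtain ⟨a₁', b₁'⟩ := hblk n₁' hn₁'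
    obtain ⟨a₂, b₂⟩ := hblk n₂ hn₂
    obtain ⟨a₂', b₂'⟩ := hblk n₂' hn₂'
    have htags : joinTags (n₁ - joinShift) (n₁' - joinShift) χ₁ χ₂ k₁ =
        joinTags (n₂ - joinShift) (n₂' - joinShift) η₁ η₂ k₂ := by
      have h := hT₁.symm.trans hT₂
      rw [Prod.mk.injEq] at h
      exact Prod.ext (hcode h.1) (hcode h.2)
    obtain ⟨e1, e2, e3, e4, e5⟩ := joinArrow_injective _ _ _ _ _ _ _ _ _ _ hχ₁ hχ₂ b₁ b₁' hk₁
      hη₁ hη₂ b₂ b₂' hk₂ (by omega) (hW₁.symm.trans hW₂) (hS₁.symm.trans hS₂) htags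
    have en : n₁ = n₂ := by omega
    have en' : n₁' = n₂' := by omega
    subst en en' e3 e4 e5
    rfl
  -- the estimate
  set g : ((_ : (_ : ℕ) × (ℕ → Site 2)) × Site 2) × (ℕ × ℕ) → ℝ :=
    fun u => criticalFugacity⁻¹ ^ 16 * criticalFugacity ^ (u.1.1.1 - joinShift + 1) with hg
  have hg0 : ∀ u, 0 ≤ g u := fun u =>
    mul_nonneg (pow_nonneg (inv_nonneg.2 hx0.le) _) (pow_nonneg hx0.le _)
  have hstep1 : Dent i = ∑ t ∈ T, g (Φ t) := by
    rw [hL]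
    exact Finset.sum_congr rfl fun t ht => (hΦ t ht).2.1
  have hstep2 : ∑ u ∈ T.image Φ, g u = ∑ t ∈ T, g (Φ t) := Finset.sum_image hinj
  have hsub : T.image Φ ⊆ U := Finset.image_subset_iff.2 fun t ht => (hΦ t ht).1
  have hstep3 : ∑ u ∈ T.image Φ, g u ≤ ∑ u ∈ U, g u :=
    Finset.sum_le_sum_of_subset_of_nonneg hsub fun u _ _ => hg0 u
  have hR' : 64 * criticalFugacity⁻¹ ^ 16 * Urar i = ∑ u ∈ U, g u := hR
  rw [hstep1, ← hstep2, hR']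
  exact hstep3

end Summit.CriticalPhenomena.SAWScalingLimit.Theorems.CriticalBubbleBound.Join

end
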